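import Summits.NavierStokesRegularity.NavierStokesRegularity.Theorems.SoloRefuteSiche2026Shear
import HarnessLib

/-!
# C135 `Siche2026` — the typed coherence of ANY field whose shell is carried by `±n e₀`, `ŷ`-polarised

Field-general form of `SoloRefuteSiche2026Shear` (for the face-(A) assembly, where the velocity is an
infinite lacunary shear series / a heat flow given through its Fourier coefficients rather than as a
`realTrigPoly`): if on the shell `S_K ∋ n e₀` (`n > 0`) a real field `v` has vector Fourier coefficients
`v̂(n e₀) = (0, β, 0)`, `v̂(-n e₀) = (0, β̄, 0)` and `v̂(k) = 0` at every other `k ∈ S_K`, then in gauge (39)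
`c^σ_{±n e₀} = ±β^{(−)}/√2`, `ā_K = 2√2|β|/N_K`, `m_K(x) = i·Im(β e_{n e₀}(x))/|β|` and
`χ_K(x) = N_K · Im(β e_{n e₀}(x))²/|β|²`; at `x = 0`, `χ_K(0) = N_K (Im β)²/|β|²` — `= N_K` for a SINE
profile (`β ∈ iℝ`, e.g. `β = -i b e^{-4π²νn²t}/2` along a shear heat flow), `= 0` for a COSINE profile.

WHAT THIS IS NOT: not a claim about NS regularity or blow-up; not a claim about any author beyond the
typed locator.
-/

set_option linter.dupNamespace false

noncomputable section

open Literature.Analysis.FunctionSpaces Literature.Analysis.FunctionSpaces.Torus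
open Literature.Claims.NS.Siche2026
open UnitAddTorus (mFourier mFourierCoeff)
open scoped ComplexConjugate

namespace Summit.NavierStokesRegularity.NavierStokesRegularity.Theorems.Siche2026

section AxisField

variable {v : T3 → E3} {n : ℤ} {K : ℕ} {β : ℂ}

/-- a sum over a shell of a function vanishing on the shell away from `{n e₀, -n e₀}`. [folklore] -/
theorem sum_shell_eq_of_mem {n : ℤ} (hn : n ≠ 0) {K : ℕ} (g : Z3 → ℂ)
    (hg : ∀ k ∈ shell K, k ≠ kx n → k ≠ -kx n → g k = 0) :
    ∑ k ∈ shell K, g k = (if kx n ∈ shell K then g (kx n) else 0) +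
      (if -kx n ∈ shell K then g (-kx n) else 0) := by
  classical
  have key : ∀ k ∈ shell K,
      g k = (if k = kx n then g (kx n) else 0) + (if k = -kx n then g (-kx n) else 0) := by
    intro k hk
    by_cases h1 : k = kx n
    · subst h1; rw [if_pos rfl, if_neg (kx_ne_neg hn), add_zero]
    · by_cases h2 : k = -kx n
      · subst h2; rw [if_neg h1, if_pos rfl, zero_add]
      · rw [if_neg h1, if_neg h2, add_zero, hg k hk h1 h2]
  rw [Finset.sum_congr rfl key, Finset.sum_add_distrib, Finset.sum_ite_eq', Finset.sum_ite_eq']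

/-- `c^σ_{n e₀} = β/√2` when `v̂(n e₀) = (0, β, 0)`, `n > 0`. [cite: Siche2026, §2.1 (4) p. 3; §6.6 (39) p. 15] -/
theorem helCoeff_axis_pos (hn : 0 < n) (hc : coeff v (kx n) = yC β) (σ : Bool) :
    helCoeff v (kx n) σ = β / Real.sqrt 2 := by
  rw [helCoeff_eq_of_frame (frame₁_kx hn) (frame₂_kx hn) hc σ]
  push_cast; ring

/-- `c^σ_{-n e₀} = -β̄/√2` when `v̂(-n e₀) = (0, β̄, 0)`, `n > 0`. [cite: Siche2026, §2.1 (4) p. 3; §6.6 (39) p. 15] -/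
theorem helCoeff_axis_neg (hn : 0 < n) (hc : coeff v (-kx n) = yC (conj β)) (σ : Bool) :
    helCoeff v (-kx n) σ = -(conj β / Real.sqrt 2) := by
  have e1 : frame₁ (-kx n) = ![0, (-1 : ℝ), 0] := by rw [neg_kx]; exact frame₁_kx_neg hn
  have e2 : frame₂ (-kx n) = ![0, 0, 1] := by rw [neg_kx]; exact frame₂_kx_neg hn
  rw [helCoeff_eq_of_frame e1 e2 hc σ]
  push_cast; ring

/-- silent modes have zero helical coordinates. [folklore] -/
theorem helCoeff_eq_zero_of_coeff {k : Z3} (hc : coeff v k = 0) (σ : Bool) : helCoeff v k σ = 0 := by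
  unfold helCoeff; rw [hc, inner_zero_right]

/-- **mean amplitude** `ā_K = 2√2 |β| / N_K` of an axis-carried shell. [cite: Siche2026, Definition 4.1 p. 7] -/
theorem meanAmp_axis (hn : 0 < n) (hK : kx n ∈ shell K) (hp : coeff v (kx n) = yC β)
    (hm : coeff v (-kx n) = yC (conj β)) (h0 : ∀ k ∈ shell K, k ≠ kx n → k ≠ -kx n → coeff v k = 0) :
    meanAmp v K = (shellModes K : ℝ)⁻¹ * (2 * Real.sqrt 2 * ‖β‖) := by
  unfold meanAmp
  congr 1
  have hsum := sum_shell_eq_of_mem hn.ne' (K := K)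
    (fun k => ((‖helCoeff v k true‖ + ‖helCoeff v k false‖ : ℝ) : ℂ))
    (fun k hk h1 h2 => by
      rw [helCoeff_eq_zero_of_coeff (h0 k hk h1 h2), helCoeff_eq_zero_of_coeff (h0 k hk h1 h2)]; simp)
  rw [if_pos hK, if_pos ((neg_kx_mem_shell_iff n K).2 hK),
    helCoeff_axis_pos hn hp true, helCoeff_axis_pos hn hp false, helCoeff_axis_neg hn hm true,
    helCoeff_axis_neg hn hm false] at hsum
  have hsum' := congrArg Complex.re hsum
  rw [← Complex.ofReal_sum] at hsum'
  simp only [Complex.ofReal_re, Complex.add_re] at hsum'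
  rw [hsum']
  simp only [norm_neg, norm_div, Complex.norm_conj, Complex.norm_real,
    Real.norm_of_nonneg (Real.sqrt_nonneg 2)]
  have h2 : Real.sqrt 2 ≠ 0 := by positivity
  have hs : Real.sqrt 2 ^ 2 = 2 := Real.sq_sqrt (by norm_num)
  field_simp
  rw [hs]; ring

/-- the shell sum in `m_K(x)`: `√2 (β e − β̄ ē)`. [cite: Siche2026, Definition 4.1 p. 7] -/
theorem sum_magnetization_axis (hn : 0 < n) (hK : kx n ∈ shell K) (hp : coeff v (kx n) = yC β)
    (hm : coeff v (-kx n) = yC (conj β)) (h0 : ∀ k ∈ shell K, k ≠ kx n → k ≠ -kx n → coeff v k = 0)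
    (x : T3) :
    ∑ k ∈ shell K, mFourier k x * (helCoeff v k true + helCoeff v k false) =
      Real.sqrt 2 * (mFourier (kx n) x * β - conj (mFourier (kx n) x * β)) := by
  rw [sum_shell_eq_of_mem hn.ne' (K := K) _ (fun k hk h1 h2 => by
    rw [helCoeff_eq_zero_of_coeff (h0 k hk h1 h2), helCoeff_eq_zero_of_coeff (h0 k hk h1 h2), add_zero,
      mul_zero])]
  rw [if_pos hK, if_pos ((neg_kx_mem_shell_iff n K).2 hK), helCoeff_axis_pos hn hp true,
    helCoeff_axis_pos hn hp false, helCoeff_axis_neg hn hm true, helCoeff_axis_neg hn hm false,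
    UnitAddTorus.mFourier_neg, map_mul]
  have h2 : (Real.sqrt 2 : ℂ) ≠ 0 := by exact_mod_cast (show Real.sqrt 2 ≠ 0 by positivity)
  have hs : (Real.sqrt 2 : ℂ) ^ 2 = 2 := by
    rw [← Complex.ofReal_pow, Real.sq_sqrt (by norm_num : (0:ℝ) ≤ 2)]; norm_num
  field_simp
  rw [hs]; ring

/-- **magnetisation of an axis-carried shell**: `m_K(x) = i·Im(β e_{n e₀}(x))/|β|` (`β ≠ 0`).
[cite: Siche2026, Definition 4.1 p. 7] -/
theorem magnetization_axis (hn : 0 < n) (hK : kx n ∈ shell K) (hβ : β ≠ 0) (hp : coeff v (kx n) = yC β)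
    (hm : coeff v (-kx n) = yC (conj β)) (h0 : ∀ k ∈ shell K, k ≠ kx n → k ≠ -kx n → coeff v k = 0)
    (x : T3) :
    magnetization v K x = Complex.I * ((mFourier (kx n) x * β).im : ℂ) / (‖β‖ : ℂ) := by
  unfold magnetization
  rw [sum_magnetization_axis hn hK hp hm h0, meanAmp_axis hn hK hp hm h0]
  have hN : (shellModes K : ℂ) ≠ 0 := by
    have : 0 < shellModes K := by
      unfold shellModes
      have : 0 < (shell K).card := Finset.card_pos.2 ⟨_, hK⟩
      omega
    exact_mod_cast this.ne'
  have h2 : (Real.sqrt 2 : ℂ) ≠ 0 := by exact_mod_cast (show Real.sqrt 2 ≠ 0 by positivity)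
  have hβ' : (‖β‖ : ℂ) ≠ 0 := by exact_mod_cast (norm_ne_zero_iff.2 hβ)
  rw [sub_conj_eq]
  push_cast
  field_simp

/-- **coherence of an axis-carried shell**: `χ_K(x) = N_K · Im(β e_{n e₀}(x))² / |β|²` (`β ≠ 0`).
[cite: Siche2026, Definition 4.1 p. 7] -/
theorem coherence_axis (hn : 0 < n) (hK : kx n ∈ shell K) (hβ : β ≠ 0) (hp : coeff v (kx n) = yC β)
    (hm : coeff v (-kx n) = yC (conj β)) (h0 : ∀ k ∈ shell K, k ≠ kx n → k ≠ -kx n → coeff v k = 0)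
    (x : T3) :
    coherence v K x = (shellModes K : ℝ) * ((mFourier (kx n) x * β).im ^ 2 / ‖β‖ ^ 2) := by
  unfold coherence
  rw [magnetization_axis hn hK hβ hp hm h0 x, norm_div, norm_mul, Complex.norm_I, one_mul,
    Complex.norm_real, Complex.norm_real, Real.norm_eq_abs, Real.norm_of_nonneg (norm_nonneg β),
    div_pow, sq_abs]

/-- **at `x = 0`**: `χ_K(0) = N_K (Im β)²/|β|²`. [cite: Siche2026, Definition 4.1 p. 7] -/
theorem coherence_axis_zero (hn : 0 < n) (hK : kx n ∈ shell K) (hβ : β ≠ 0) (hp : coeff v (kx n) = yC β)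
    (hm : coeff v (-kx n) = yC (conj β)) (h0 : ∀ k ∈ shell K, k ≠ kx n → k ≠ -kx n → coeff v k = 0) :
    coherence v K 0 = (shellModes K : ℝ) * (β.im ^ 2 / ‖β‖ ^ 2) := by
  rw [coherence_axis hn hK hβ hp hm h0 0]
  simp [UnitAddTorus.mFourier]

/-- **SINE profiles are fully coherent at `x = 0`**: if `β = i r` with `r ≠ 0` real (e.g.
`β = -i b e^{-4π²νn²t}/2`), then `χ_K(0) = N_K`. [cite: Siche2026, Definition 4.1 p. 7 («For fully coherent
(aligned) phases, χ_K = N_K»)] -/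
theorem coherence_axis_zero_of_imaginary (hn : 0 < n) (hK : kx n ∈ shell K) {r : ℝ} (hr : r ≠ 0)
    (hp : coeff v (kx n) = yC (Complex.I * r)) (hm : coeff v (-kx n) = yC (conj (Complex.I * r)))
    (h0 : ∀ k ∈ shell K, k ≠ kx n → k ≠ -kx n → coeff v k = 0) :
    coherence v K 0 = shellModes K := by
  have hβ : (Complex.I * r : ℂ) ≠ 0 := mul_ne_zero Complex.I_ne_zero (by exact_mod_cast hr)
  rw [coherence_axis_zero hn hK hβ hp hm h0]
  have h1 : (Complex.I * (r : ℂ)).im = r := by simp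
  have h2 : ‖Complex.I * (r : ℂ)‖ = |r| := by simp
  rw [h1, h2, sq_abs, div_self (pow_ne_zero 2 hr), mul_one]

/-- **COSINE profiles are incoherent at `x = 0` but fully coherent at the quarter period**: if `β = r ≠ 0` is
real then `χ_K(0) = 0`. [cite: Siche2026, Definition 4.1 p. 7; Theorem 7.1 (53) p. 23] -/
theorem coherence_axis_zero_of_real (hn : 0 < n) (hK : kx n ∈ shell K) {r : ℝ} (hr : r ≠ 0)
    (hp : coeff v (kx n) = yC r) (hm : coeff v (-kx n) = yC (conj (r : ℂ)))
    (h0 : ∀ k ∈ shell K, k ≠ kx n → k ≠ -kx n → coeff v k = 0) :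
    coherence v K 0 = 0 := by
  have hβ : (r : ℂ) ≠ 0 := by exact_mod_cast hr
  rw [coherence_axis_zero hn hK hβ hp hm h0]
  simp

/-- a shell on which EVERY coefficient vanishes is silent: `χ_K ≡ 0`. [folklore] -/
theorem coherence_eq_zero_of_silent (h0 : ∀ k ∈ shell K, coeff v k = 0) (x : T3) : coherence v K x = 0 := by
  unfold coherence magnetization
  rw [Finset.sum_eq_zero fun k hk => by
    rw [helCoeff_eq_zero_of_coeff (h0 k hk), helCoeff_eq_zero_of_coeff (h0 k hk), add_zero, mul_zero]]
  simp

end AxisField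

end Summit.NavierStokesRegularity.NavierStokesRegularity.Theorems.Siche2026
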